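import Summits.BirchSwinnertonDyer.BirchSwinnertonDyer.Theorems.ManinLocalTwoThreeShiftConjugationInvariance
import Summits.BirchSwinnertonDyer.BirchSwinnertonDyer.Theorems.ManinLocalTwoThreeHeckeCongruenceCharacter
import Summits.BirchSwinnertonDyer.BirchSwinnertonDyer.Theorems.ManinLocalTwoThreeEisensteinEnd
import Literature.NumberTheory.EllipticCurves.Gamma0CocycleDegeneracyHecke
import HarnessLib

/-!
# E-es-42 `AtkinLehnerStep` modulo σ2: a `t`-shift-invariant generalised eigen-homomorphism on `Γ₀(L′t)` with hNT(`t`) is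
# invariant under the Atkin–Lehner conjugation `Ad(W)`, `W = diag(1,t)·h` (`h ∈ Γ₀(L′)`, `t ∣ a_h`)

Summit `BirchSwinnertonDyer`, route `ManinLocalTwoThree` (cell bsd-f2-manin), deciding crux C2 `ManinOddAtFour`
(stmt-BirchSwinnertonDyer-22967), skeleton `kato_shift_two` v6, stub 3 `stub_cThreeImageResidual` (`C₃` residual; es §25).  In the
corrected vertex step (MEMO-es §25.3 (V-b)/§25.9, es 2026-08-28T04:00Z) the one consistency condition is «`u` is
`W_t`-invariant», typed as **E-es-42 `EsG12.AtkinLehnerStep p t`** (HOME/es/Sketch-es-g12.lean).  This file proves it MODULO σ2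
(representative-permutation: `u ∘ Ad(W)` is again a generalised eigenvector — p2's lane, taken as the hypothesis `hσ2` in
exactly the shape p2 is asked to land):

* `apply_eq_of_shiftInvariant_d` — entry form of `π_d^* u = π_1^* u` for a general modulus `d`;
* `dvd_conj_apply_zero_one` / `dvd_conj_apply_one_zero`, `exists_atkinLehnerHom` — for `h ∈ Γ₀(L′)` with `t ∣ a_h`,
  `γ ↦ β` with `hγh⁻¹ = diag(t,1) β diag(t,1)⁻¹` (entrywise, es's `IsShiftConj`) is a well-defined endomorphism `Ad(W)` of
  `Γ₀(L′t)` (`t` divides the upper-right entry of `hγh⁻¹`; shifts multiply; `shiftConj_unique`);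
* **`atkinLehner_invariant_of_heckeGenEigen`** — `c := u∘Ad(W) − u` kills `Γ₀(L′t) ∩ Γ(t^e)`: for deep `γ`, `hγh⁻¹ ∈ Γ₀(L′t)`
  has the `u`-value of `γ` (`exists_good_of_mem_Delta` at `ι h ∈ Δ_t(L′)`, E-es-38 part 2, p1) and is the `t`-shift of
  `Ad(W)γ` (shift invariance); LEMMA C (p604131, modulus `t^e`) + hNT + σ2 ⟹ `c = 0`;
* `atkinLehnerStep_of_sigma2 (p t) (hσ2) : <body of EsG12.AtkinLehnerStep p t VERBATIM, defs unfolded>` — the cusp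
  hypothesis `KillsCuspsZeroInfty` is carried but not used.

No new definitions; nothing about BSD or Manin's conjecture is proved here.  References: HOME/MEMO-es.md §25.3 (V-b), §25.9,
§25.10 CHECK 2 (the double coset `W diag(1,r) W⁻¹`); A. O. L. Atkin, J. Lehner, Math. Ann. 185 (1970) (the involutions `W`).
-/

set_option autoImplicit false
set_option linter.dupNamespace false

open scoped MatrixGroups

open CongruenceSubgroup Matrix.SpecialLinearGroup Literature.NumberTheory.EllipticCurves.ModularForms
  Literature.NumberTheory.EllipticCurves.ModularForms.HidaCohomology
  Summit.BirchSwinnertonDyer.BirchSwinnertonDyer.Theorems.ConjSpanGenAllLevels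

namespace Summit.BirchSwinnertonDyer.BirchSwinnertonDyer.Theorems.ManinLocalTwoThree

/-! ### Shift invariance on entries, general modulus `d` -/

section ShiftInvarianceD

variable {d L : ℕ} {K : Type*} [CommRing K] {u : Gamma0 L → Fin 1 → K}

/-- **`d`-shift invariance on entries**: `π_d^* u = π_1^* u` on `Γ₀(L d)` says `u(γ') = u(γ)` whenever `γ' ∈ Γ₀(L)` is the
`d`-shift of `γ ∈ Γ₀(L)` (general `d`; the `tⁿ` case is `apply_eq_of_shiftInvariant`). [cite: Shimura1971, §8.3 (8.3.2)] -/
theorem apply_eq_of_shiftInvariant_d [NeZero d] [NeZero L]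
    (hshift : degeneracyPullback 0 L (L * d) d K dvd_rfl u = degeneracyPullback 0 L (L * d) 1 K (by simp) u)
    (γ γ' : Gamma0 L)
    (hR : (γ' : SL(2, ℤ)) 0 0 = (γ : SL(2, ℤ)) 0 0 ∧ (γ' : SL(2, ℤ)) 0 1 = (d : ℤ) * (γ : SL(2, ℤ)) 0 1 ∧
      (d : ℤ) * (γ' : SL(2, ℤ)) 1 0 = (γ : SL(2, ℤ)) 1 0 ∧ (γ' : SL(2, ℤ)) 1 1 = (γ : SL(2, ℤ)) 1 1) :
    u γ' = u γ := by
  obtain ⟨h1, h2, h3, h4⟩ := hR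
  have hL : (L : ℤ) ∣ (γ' : SL(2, ℤ)) 1 0 := ManinFrameResidueProperRTameTwist.natCast_dvd_entry10 γ'
  have hmem : (γ : SL(2, ℤ)) ∈ Gamma0 (L * d) := by
    rw [Gamma0_mem]
    have hd : ((L * d : ℕ) : ℤ) ∣ (γ : SL(2, ℤ)) 1 0 := by
      rw [← h3]
      push_cast
      rw [mul_comm ((L : ℤ))]
      exact mul_dvd_mul_left _ hL
    exact (ZMod.intCast_zmod_eq_zero_iff_dvd _ _).mpr hd
  have h := congrFun hshift ⟨γ, hmem⟩
  rw [degeneracyPullback_zero_apply, degeneracyPullback_zero_apply] at h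
  have hd0 : (d : ℤ) ≠ 0 := by exact_mod_cast NeZero.ne d
  have e1 : Gamma0.degeneracyConj L (L * d) d dvd_rfl ⟨γ, hmem⟩ = γ' := by
    apply Subtype.ext
    ext i j
    rw [Gamma0.degeneracyConj_apply]
    fin_cases i <;> fin_cases j
    · exact h1.symm
    · exact h2.symm
    · show (γ : SL(2, ℤ)) 1 0 / (d : ℤ) = (γ' : SL(2, ℤ)) 1 0
      rw [← h3]
      exact Int.mul_ediv_cancel_left _ hd0
    · exact h4.symm
  have e2 : Gamma0.degeneracyConj L (L * d) 1 (by simp) ⟨γ, hmem⟩ = γ :=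
    Subtype.ext (Gamma0.coe_degeneracyConj_one _ _)
  rw [e1, e2] at h
  exact h

end ShiftInvarianceD

/-! ### The Atkin–Lehner conjugation `Ad(W)`, `W = diag(1,t) h`, on `Γ₀(L′t)` -/

section AtkinLehnerConj

variable (t L' : ℕ)

/-- Entries of `h γ h⁻¹` (plumbing). [folklore] -/
theorem conj_apply_zero_one (h γ : SL(2, ℤ)) :
    (h * γ * h⁻¹) 0 1 = h 0 0 * h 0 1 * (γ 1 1 - γ 0 0) + h 0 0 ^ 2 * γ 0 1 - h 0 1 ^ 2 * γ 1 0 := by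
  simp [coe_mul, coe_inv, Matrix.adjugate_fin_two, Matrix.mul_apply, Fin.sum_univ_two]
  ring

/-- Entries of `h γ h⁻¹` (plumbing). [folklore] -/
theorem conj_apply_one_zero (h γ : SL(2, ℤ)) :
    (h * γ * h⁻¹) 1 0 = h 1 0 * h 1 1 * (γ 0 0 - γ 1 1) + h 1 1 ^ 2 * γ 1 0 - h 1 0 ^ 2 * γ 0 1 := by
  simp [coe_mul, coe_inv, Matrix.adjugate_fin_two, Matrix.mul_apply, Fin.sum_univ_two]
  ring

/-- **`t` divides the upper-right entry of `h γ h⁻¹`** for `h ∈ Γ₀(L′)` with `t ∣ a_h` and `γ ∈ Γ₀(L′t)` — so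
`W γ W⁻¹ = diag(1,t) hγh⁻¹ diag(1,t)⁻¹` is an integer matrix. [folklore] -/
theorem dvd_conj_apply_zero_one (h : SL(2, ℤ)) (hth : (t : ℤ) ∣ h 0 0) (γ : Gamma0 (L' * t)) :
    (t : ℤ) ∣ (h * (γ : SL(2, ℤ)) * h⁻¹) 0 1 := by
  have htd : (t : ℤ) ∣ ((L' * t : ℕ) : ℤ) := ⟨(L' : ℤ), by push_cast; ring⟩
  have hc : (t : ℤ) ∣ (γ : SL(2, ℤ)) 1 0 := htd.trans (ManinFrameResidueProperRTameTwist.natCast_dvd_entry10 γ)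
  rw [conj_apply_zero_one]
  exact ((hth.mul_right _).mul_right _).add ((hth.pow two_ne_zero |>.mul_right _)) |>.sub (hc.mul_left _)

/-- **`L′` divides the lower-left entry of `h γ h⁻¹`** for `h ∈ Γ₀(L′)`, `γ ∈ Γ₀(L′t)`. [folklore] -/
theorem dvd_conj_apply_one_zero (h : Gamma0 L') (γ : Gamma0 (L' * t)) :
    (L' : ℤ) ∣ ((h : SL(2, ℤ)) * (γ : SL(2, ℤ)) * (h : SL(2, ℤ))⁻¹) 1 0 := by
  have hLd : (L' : ℤ) ∣ ((L' * t : ℕ) : ℤ) := ⟨(t : ℤ), by push_cast; rfl⟩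
  have hc : (L' : ℤ) ∣ (γ : SL(2, ℤ)) 1 0 := hLd.trans (ManinFrameResidueProperRTameTwist.natCast_dvd_entry10 γ)
  have hh : (L' : ℤ) ∣ (h : SL(2, ℤ)) 1 0 := ManinFrameResidueProperRTameTwist.natCast_dvd_entry10 h
  rw [conj_apply_one_zero]
  exact ((hh.mul_right _).mul_right _).add (hc.mul_left _) |>.sub ((hh.pow two_ne_zero).mul_right _)

end AtkinLehnerConj

/-! ### Existence and uniqueness of the Atkin–Lehner conjugate `β = W γ W⁻¹` -/

section AtkinLehnerHom

variable (t L' : ℕ)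

/-- Uniqueness of the integer down-shift (plumbing: `t ≠ 0` cancels). [folklore] -/
theorem shiftConj_unique {t : ℕ} (ht : t ≠ 0) {X β β' : SL(2, ℤ)}
    (hβ : X 0 0 = β 0 0 ∧ X 0 1 = (t : ℤ) * β 0 1 ∧ (t : ℤ) * X 1 0 = β 1 0 ∧ X 1 1 = β 1 1)
    (hβ' : X 0 0 = β' 0 0 ∧ X 0 1 = (t : ℤ) * β' 0 1 ∧ (t : ℤ) * X 1 0 = β' 1 0 ∧ X 1 1 = β' 1 1) : β = β' := by
  have htZ : (t : ℤ) ≠ 0 := by exact_mod_cast ht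
  obtain ⟨h1, h2, h3, h4⟩ := hβ
  obtain ⟨k1, k2, k3, k4⟩ := hβ'
  ext i j
  fin_cases i <;> fin_cases j
  · exact h1.symm.trans k1
  · exact mul_left_cancel₀ htZ (h2.symm.trans k2)
  · exact h3.symm.trans k3
  · exact h4.symm.trans k4

/-- **The Atkin–Lehner conjugation `Ad(W)` on `Γ₀(L′t)` as a group homomorphism** (`W = diag(1,t)·h`, `h ∈ Γ₀(L′)`,
`t ∣ a_h`, `t` prime to `L′` not needed here): `γ ↦ β` with `h γ h⁻¹ = diag(t,1) β diag(t,1)⁻¹` entrywise.  Existence: `t`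
divides the upper-right entry of `hγh⁻¹`; multiplicativity: shifts multiply and are unique. [folklore] -/
theorem exists_atkinLehnerHom (ht : t ≠ 0) (h : Gamma0 L') (hth : (t : ℤ) ∣ (h : SL(2, ℤ)) 0 0) :
    ∃ Φ : Gamma0 (L' * t) →* Gamma0 (L' * t), ∀ γ : Gamma0 (L' * t),
      ((h : SL(2, ℤ)) * (γ : SL(2, ℤ)) * (h : SL(2, ℤ))⁻¹) 0 0 = (Φ γ : SL(2, ℤ)) 0 0 ∧
      ((h : SL(2, ℤ)) * (γ : SL(2, ℤ)) * (h : SL(2, ℤ))⁻¹) 0 1 = (t : ℤ) * (Φ γ : SL(2, ℤ)) 0 1 ∧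
      (t : ℤ) * ((h : SL(2, ℤ)) * (γ : SL(2, ℤ)) * (h : SL(2, ℤ))⁻¹) 1 0 = (Φ γ : SL(2, ℤ)) 1 0 ∧
      ((h : SL(2, ℤ)) * (γ : SL(2, ℤ)) * (h : SL(2, ℤ))⁻¹) 1 1 = (Φ γ : SL(2, ℤ)) 1 1 := by
  classical
  -- the conjugate of each `γ`, as an element of `Γ₀(L′t)`
  have hex : ∀ γ : Gamma0 (L' * t), ∃ β : Gamma0 (L' * t),
      ((h : SL(2, ℤ)) * (γ : SL(2, ℤ)) * (h : SL(2, ℤ))⁻¹) 0 0 = (β : SL(2, ℤ)) 0 0 ∧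
      ((h : SL(2, ℤ)) * (γ : SL(2, ℤ)) * (h : SL(2, ℤ))⁻¹) 0 1 = (t : ℤ) * (β : SL(2, ℤ)) 0 1 ∧
      (t : ℤ) * ((h : SL(2, ℤ)) * (γ : SL(2, ℤ)) * (h : SL(2, ℤ))⁻¹) 1 0 = (β : SL(2, ℤ)) 1 0 ∧
      ((h : SL(2, ℤ)) * (γ : SL(2, ℤ)) * (h : SL(2, ℤ))⁻¹) 1 1 = (β : SL(2, ℤ)) 1 1 := by
    intro γ
    obtain ⟨X, hX⟩ := exists_shiftRel_down ((h : SL(2, ℤ)) * (γ : SL(2, ℤ)) * (h : SL(2, ℤ))⁻¹)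
      (dvd_conj_apply_zero_one t L' (h : SL(2, ℤ)) hth γ)
    have hXmem : X ∈ Gamma0 (L' * t) := by
      refine mem_Gamma0_of_dvd_apply_one_zero X ?_
      rw [← hX.2.2.1]
      push_cast
      rw [mul_comm ((L' : ℤ))]
      exact mul_dvd_mul_left _ (dvd_conj_apply_one_zero t L' h γ)
    exact ⟨⟨X, hXmem⟩, hX⟩
  choose f hf using hex
  have hmul : ∀ γ δ : Gamma0 (L' * t), f (γ * δ) = f γ * f δ := by
    intro γ δ
    apply Subtype.ext
    refine shiftConj_unique ht (hf (γ * δ)) ?_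
    have hprod : (h : SL(2, ℤ)) * ((γ * δ : Gamma0 (L' * t)) : SL(2, ℤ)) * (h : SL(2, ℤ))⁻¹ =
        ((h : SL(2, ℤ)) * (γ : SL(2, ℤ)) * (h : SL(2, ℤ))⁻¹) * ((h : SL(2, ℤ)) * (δ : SL(2, ℤ)) * (h : SL(2, ℤ))⁻¹) := by
      rw [Subgroup.coe_mul]; group
    rw [hprod, Subgroup.coe_mul]
    exact shiftRel_mul (t : ℤ) (hf γ) (hf δ)
  exact ⟨MonoidHom.mk' f hmul, fun γ ↦ hf γ⟩

end AtkinLehnerHom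

/-! ### E-es-42 modulo σ2: `Ad(W)`-invariance from LEMMA C, hNT and the GOODness of `ι Γ₀(L′) ⊆ Δ_t(L′)` -/

section AtkinLehner

/-- **E-es-42 `AtkinLehnerStep`, core, modulo σ2.**  `t` prime, `t ∤ L′`; `u ∈ Z¹(Γ₀(L′t), K)` a generalised Hecke
eigen-homomorphism off `S ⊇ primes(p t L′)`, `t`-shift-invariant (`π_t^* u = π_1^* u` on `Γ₀(L′t·t)`), hNT(`t`); `h ∈ Γ₀(L′)`
with `t ∣ a_h` and `Φ = Ad(W)` the conjugation by `W = diag(1,t)·h` on `Γ₀(L′t)` (`exists_atkinLehnerHom`).  HYPOTHESIS σ2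
(p2's lane): `u ∘ Φ` is again a generalised `λ`-eigenvector off `S`.  CONCLUSION: `u ∘ Φ = u`.
Proof: `c := u∘Φ − u` kills `Γ₀(L′t) ∩ Γ(t^e)`: for deep `γ`, `hγh⁻¹ ∈ Γ₀(L′t)` has the same `u`-value as `γ`
(`exists_good_of_mem_Delta` at `ι h ∈ Δ_t(L′)`, E-es-38 part 2) and is the `t`-shift of `Φ γ` (shift invariance); then LEMMA
C (modulus `t^e`) makes `c` an exact `(r+1)`-eigenvector of `T_r` for `r ≡ 1 (mod t^e)`, hNT picks such an `r ∉ S` with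
`λ(r) ≠ r + 1`, and `c` is generalised `λ(r)`-eigen, so `c = 0`.  The cusp hypothesis of E-es-42 is not needed.
[cite: Shimura1971, §8.3 (8.3.2)] -/
theorem atkinLehner_invariant_of_heckeGenEigen {p t L' : ℕ} (ht : t.Prime) (hL' : ¬ t ∣ L')
    {K : Type} [Field K] [CharP K p] [NeZero L'] [NeZero t] (S : Finset ℕ) (lam : ℕ → K) (u : cocycles 0 (L' * t) K)
    (hS : ∀ q : ℕ, q.Prime → q ∣ p * t * L' → q ∈ S) (hgen : IsHeckeGenEigenvector S lam u)
    (hNT : ∀ M : ℕ, ∃ r : ℕ, r.Prime ∧ r ∉ S ∧ r ≡ 1 [MOD t ^ M] ∧ lam r ≠ (r : K) + 1)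
    (hshift : degeneracyPullback 0 (L' * t) (L' * t * t) t K dvd_rfl (u : Gamma0 (L' * t) → Fin 1 → K) =
      degeneracyPullback 0 (L' * t) (L' * t * t) 1 K (by simp) (u : Gamma0 (L' * t) → Fin 1 → K))
    (h : Gamma0 L') (Φ : Gamma0 (L' * t) →* Gamma0 (L' * t))
    (hΦ : ∀ γ : Gamma0 (L' * t),
      ((h : SL(2, ℤ)) * (γ : SL(2, ℤ)) * (h : SL(2, ℤ))⁻¹) 0 0 = (Φ γ : SL(2, ℤ)) 0 0 ∧
      ((h : SL(2, ℤ)) * (γ : SL(2, ℤ)) * (h : SL(2, ℤ))⁻¹) 0 1 = (t : ℤ) * (Φ γ : SL(2, ℤ)) 0 1 ∧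
      (t : ℤ) * ((h : SL(2, ℤ)) * (γ : SL(2, ℤ)) * (h : SL(2, ℤ))⁻¹) 1 0 = (Φ γ : SL(2, ℤ)) 1 0 ∧
      ((h : SL(2, ℤ)) * (γ : SL(2, ℤ)) * (h : SL(2, ℤ))⁻¹) 1 1 = (Φ γ : SL(2, ℤ)) 1 1)
    (hσ2 : ∀ huΦ : (fun γ ↦ (u : Gamma0 (L' * t) → Fin 1 → K) (Φ γ)) ∈ cocycles 0 (L' * t) K,
      IsHeckeGenEigenvector S lam ⟨_, huΦ⟩) :
    ∀ γ : Gamma0 (L' * t), (u : Gamma0 (L' * t) → Fin 1 → K) (Φ γ) = (u : Gamma0 (L' * t) → Fin 1 → K) γ := by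
  classical
  have ht0 : t ≠ 0 := ht.ne_zero
  haveI : NeZero (L' * t) := inferInstance
  set uf : Gamma0 (L' * t) → Fin 1 → K := (u : Gamma0 (L' * t) → Fin 1 → K) with huf
  have hu : uf ∈ cocycles 0 (L' * t) K := u.2
  -- entry form of the `t`-shift invariance (scalar `t = t ^ 1`)
  have hshd := apply_eq_of_shiftInvariant_d hshift
  have hsh1 : ∀ γ γ' : Gamma0 (L' * t), ((γ' : SL(2, ℤ)) 0 0 = (γ : SL(2, ℤ)) 0 0 ∧
      (γ' : SL(2, ℤ)) 0 1 = (t : ℤ) ^ 1 * (γ : SL(2, ℤ)) 0 1 ∧ (t : ℤ) ^ 1 * (γ' : SL(2, ℤ)) 1 0 = (γ : SL(2, ℤ)) 1 0 ∧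
      (γ' : SL(2, ℤ)) 1 1 = (γ : SL(2, ℤ)) 1 1) → uf γ' = uf γ := by
    intro γ γ' hR
    rw [pow_one] at hR
    exact hshd γ γ' hR
  -- `ι h ∈ Δ_t(L′)` is GOOD: conjugation by `h` preserves `u` on deep elements
  have hL : L' * t = t ^ 1 * L' := by ring
  have hιh : ConjSpanGenAllLevels.iota t (h : SL(2, ℤ)) ∈ Delta t L' := by
    obtain ⟨q, hq⟩ := ManinFrameResidueProperRTameTwist.natCast_dvd_entry10 h
    exact ⟨(q : Away t), by rw [ConjSpanGenAllLevels.iota_apply, hq]; push_cast; rfl⟩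
  obtain ⟨e, hgood⟩ := exists_good_of_mem_Delta t 1 1 L' uf ht le_rfl hL hL' hu hsh1 hιh
  -- the twisted cocycle and the difference
  have huΦ : (fun γ ↦ uf (Φ γ)) ∈ cocycles 0 (L' * t) K := by
    rw [mem_cocycles_iff]
    intro γ δ
    show uf (Φ (γ * δ)) = uf (Φ δ) + act 0 (gmat δ) (uf (Φ γ))
    rw [map_mul, cocycle_zero_mul hu, act_zero_eq_id, LinearMap.id_apply, add_comm]
  set c : cocycles 0 (L' * t) K := ⟨_, huΦ⟩ - u with hc
  have hcoe : (c : Gamma0 (L' * t) → Fin 1 → K) = (fun γ ↦ uf (Φ γ)) - uf := by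
    rw [hc, Submodule.coe_sub]
  -- `c` kills `Γ₀(L′t) ∩ Γ(t^e)`
  haveI : NeZero (t ^ e) := ⟨pow_ne_zero _ ht0⟩
  have hkill : ∀ γ : Gamma0 (L' * t),
      (∀ i j, ((gmat γ i j : ℤ) : ZMod (t ^ e)) = (((1 : Matrix (Fin 2) (Fin 2) ℤ) i j : ℤ) : ZMod (t ^ e))) →
        (c : Gamma0 (L' * t) → Fin 1 → K) γ = 0 := by
    intro γ hγ
    have hmem : (γ : SL(2, ℤ)) ∈ Gamma (t ^ e) := by
      rw [Gamma_mem]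
      refine ⟨?_, ?_, ?_, ?_⟩
      · have h := hγ 0 0; simpa using h
      · have h := hγ 0 1; simpa using h
      · have h := hγ 1 0; simpa using h
      · have h := hγ 1 1; simpa using h
    obtain ⟨γ', hγ', -, huγ'⟩ := hgood e le_rfl γ hmem
    -- `γ' = h γ h⁻¹` and `Φ γ` is its down-shift
    have hγ'eq : (γ' : SL(2, ℤ)) = (h : SL(2, ℤ)) * (γ : SL(2, ℤ)) * (h : SL(2, ℤ))⁻¹ := by
      apply iota_injective ht0
      rw [hγ', map_mul, map_mul, map_inv]
    have hR := hΦ γ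
    rw [← hγ'eq] at hR
    have h1 : uf γ' = uf (Φ γ) := hshd (Φ γ) γ' hR
    rw [hcoe, Pi.sub_apply, sub_eq_zero]
    show uf (Φ γ) = uf γ
    rw [← h1, huγ']
  -- a prime `r ≡ 1 (mod t^e)` outside `S` with `λ(r) ≠ r + 1`
  obtain ⟨r, hr, hrS, hrM, hlam⟩ := hNT e
  haveI : NeZero r := ⟨hr.ne_zero⟩
  have hSLt : ∀ q : ℕ, q.Prime → q ∣ L' * t → q ∈ S := fun q hq hqd ↦
    hS q hq (by rw [mul_assoc, mul_comm t L']; exact hqd.mul_left _)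
  have hrLt : ¬ r ∣ L' * t := fun hd ↦ hrS (hSLt r hr hd)
  -- LEMMA C and the generalised eigen-property
  have hC := heckeU_eq_smul_of_kills_congruence hr c.2 hkill hrLt hrM
  have hT : heckeUZ 0 (L' * t) K hr c = ((r : K) + 1) • c := by
    apply Subtype.ext
    rw [coe_heckeUZ, Submodule.coe_smul, hC]
  have hgen_c : c ∈ Module.End.maxGenEigenspace (heckeUZ 0 (L' * t) K hr) (lam r) := by
    rw [hc]
    exact Submodule.sub_mem _ (hσ2 huΦ r hr hrS) (hgen r hr hrS)
  have hc0 : c = 0 := by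
    by_contra hne
    exact hlam (eq_of_apply_eq_smul_of_mem_maxGenEigenspace _ hT hgen_c hne)
  intro γ
  have h0 := congrFun (congrArg Subtype.val hc0) γ
  rw [hcoe, Pi.sub_apply, Submodule.coe_zero, Pi.zero_apply, sub_eq_zero] at h0
  exact h0

/-- **E-es-42 `AtkinLehnerStep p t` in the es sketch's currency, modulo σ2** (HOME/es/Sketch-es-g12.lean
`EsG12.AtkinLehnerStep`, with `NotTrivialEisensteinAt`, `KillsCuspsZeroInfty`, `IsShiftConj` unfolded; the cusp hypothesis is
carried but unused): under the extra hypothesis σ2 — every Atkin–Lehner pull-back `u ∘ Ad(W)` of `u` is a generalised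
`λ`-eigenvector off `S` (representative-permutation, p2's lane) — a `t`-shift-invariant generalised eigen-homomorphism on
`Γ₀(L′t)` with hNT(`t`) satisfies `u β = u γ` whenever `h γ h⁻¹ = diag(t,1) β diag(t,1)⁻¹`, `h ∈ Γ₀(L′)`, `t ∣ a_h`.
[cite: Shimura1971, §8.3 (8.3.2)] -/
theorem atkinLehnerStep_of_sigma2 (p t : ℕ)
    (hσ2 : ∀ (K : Type) [Field K] [CharP K p] (L' : ℕ) [NeZero L'] [NeZero t] (S : Finset ℕ) (lam : ℕ → K)
      (u : cocycles 0 (L' * t) K) (h : Gamma0 L') (Φ : Gamma0 (L' * t) →* Gamma0 (L' * t)),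
      (∀ γ : Gamma0 (L' * t),
        ((h : SL(2, ℤ)) * (γ : SL(2, ℤ)) * (h : SL(2, ℤ))⁻¹) 0 0 = (Φ γ : SL(2, ℤ)) 0 0 ∧
        ((h : SL(2, ℤ)) * (γ : SL(2, ℤ)) * (h : SL(2, ℤ))⁻¹) 0 1 = (t : ℤ) * (Φ γ : SL(2, ℤ)) 0 1 ∧
        (t : ℤ) * ((h : SL(2, ℤ)) * (γ : SL(2, ℤ)) * (h : SL(2, ℤ))⁻¹) 1 0 = (Φ γ : SL(2, ℤ)) 1 0 ∧
        ((h : SL(2, ℤ)) * (γ : SL(2, ℤ)) * (h : SL(2, ℤ))⁻¹) 1 1 = (Φ γ : SL(2, ℤ)) 1 1) →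
      IsHeckeGenEigenvector S lam u →
      ∀ huΦ : (fun γ ↦ (u : Gamma0 (L' * t) → Fin 1 → K) (Φ γ)) ∈ cocycles 0 (L' * t) K,
        IsHeckeGenEigenvector S lam ⟨_, huΦ⟩) :
    p.Prime → t.Prime →
    ∀ (K : Type) [Field K] [CharP K p] (L' : ℕ) [NeZero L'] [NeZero t], ¬ t ∣ L' →
    ∀ (S : Finset ℕ) (lam : ℕ → K) (u : cocycles 0 (L' * t) K),
      (∀ q : ℕ, q.Prime → q ∣ p * t * L' → q ∈ S) →
      IsHeckeGenEigenvector S lam u →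
      (∀ M : ℕ, ∃ r : ℕ, r.Prime ∧ r ∉ S ∧ r ≡ 1 [MOD t ^ M] ∧ lam r ≠ (r : K) + 1) →
      ((∀ γ : Gamma0 (L' * t), mapGL ℚ (γ : SL(2, ℤ)) • (OnePoint.infty : OnePoint ℚ) = OnePoint.infty →
          (u : Gamma0 (L' * t) → Fin 1 → K) γ = 0) ∧
        (∀ γ : Gamma0 (L' * t), mapGL ℚ (γ : SL(2, ℤ)) • ((0 : ℚ) : OnePoint ℚ) = ((0 : ℚ) : OnePoint ℚ) →
          (u : Gamma0 (L' * t) → Fin 1 → K) γ = 0)) →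
      degeneracyPullback 0 (L' * t) (L' * t * t) t K dvd_rfl (u : Gamma0 (L' * t) → Fin 1 → K) =
        degeneracyPullback 0 (L' * t) (L' * t * t) 1 K (by simp) (u : Gamma0 (L' * t) → Fin 1 → K) →
      ∀ h : Gamma0 L', (t : ℤ) ∣ (h : SL(2, ℤ)) 0 0 →
      ∀ γ β : Gamma0 (L' * t),
        (((h : SL(2, ℤ)) * (γ : SL(2, ℤ)) * (h : SL(2, ℤ))⁻¹) 0 0 = (β : SL(2, ℤ)) 0 0 ∧
          ((h : SL(2, ℤ)) * (γ : SL(2, ℤ)) * (h : SL(2, ℤ))⁻¹) 0 1 = (t : ℤ) * (β : SL(2, ℤ)) 0 1 ∧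
          (t : ℤ) * ((h : SL(2, ℤ)) * (γ : SL(2, ℤ)) * (h : SL(2, ℤ))⁻¹) 1 0 = (β : SL(2, ℤ)) 1 0 ∧
          ((h : SL(2, ℤ)) * (γ : SL(2, ℤ)) * (h : SL(2, ℤ))⁻¹) 1 1 = (β : SL(2, ℤ)) 1 1) →
        (u : Gamma0 (L' * t) → Fin 1 → K) β = (u : Gamma0 (L' * t) → Fin 1 → K) γ := by
  intro _ ht K _ _ L' _ _ hL' S lam u hS hgen hNT _ hshift h hth γ β hβ
  obtain ⟨Φ, hΦ⟩ := exists_atkinLehnerHom t L' ht.ne_zero h hth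
  have hinv := atkinLehner_invariant_of_heckeGenEigen ht hL' S lam u hS hgen hNT hshift h Φ hΦ
    (hσ2 K L' S lam u h Φ hΦ hgen)
  have hβΦ : β = Φ γ := Subtype.ext (shiftConj_unique ht.ne_zero hβ (hΦ γ))
  rw [hβΦ]
  exact hinv γ

end AtkinLehner

end Summit.BirchSwinnertonDyer.BirchSwinnertonDyer.Theorems.ManinLocalTwoThree
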